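import Mathlib
import HarnessLib
import Literature.Computability.AlgebraicComplexity.PermanentIrreducible
import Summits.ValiantsHypothesis.ValiantsHypothesis.Theorems.SchenstedIndexSeparatingPolynomial

/-!
# Route SchenstedIndex — torus-weight components and padding (step (b) of the completeness
# transfer for `BorderPcPerThree`, stmt-ValiantsHypothesis-16085)

Tools for turning the separating polynomial of step (a) (`exists_separating_polynomial_perPoly_three`:
a polynomial `p` on the coefficient space of `ℂ[x_ℓ : ℓ ∈ Fin 3 × Fin 3]` vanishing at every width-3
power trace `tr(A_M³)`, `A_M = ∑_ℓ x_ℓ M_ℓ`, and not at `per_3`) into a BALANCED one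
(`exists_balanced_separating_polynomial_perPoly_three`, next file
`SchenstedIndexBalancedSeparatingPolynomial.lean`): a polynomial `q` and `t : ℕ` such that

* every monomial `∏_k c_(d_k)` of `q` uses only coefficients `c_d` of degree-3 exponents `d` and has
  torus weight `∑_k d_k = t · J` (`J = ∑_ℓ e_ℓ`; i.e. every label `ℓ` is used exactly `t` times) —
  these are exactly the monomials that can be read on `3`-block partitions of the slot set
  `Fin t × Fin 3 × Fin 3`;
* `q` still vanishes at every `tr(A_M³)` and not at `per_3`.

Method (all elementary): the set of power traces is stable under the torus `x_ℓ ↦ λ_ℓ x_ℓ`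
(`tracePow_pencil_torus`), which acts on coefficient vectors by `c_d ↦ λ^d c_d` (`coeff_aeval_torus`);
hence every torus-weight component of `p` vanishes on it
(`eval_weightedHomogeneousComponent_eq_zero_of_torus`, a polynomial identity in `λ` read
coefficientwise via `MvPolynomial.funext`); restricting `p` to the degree-3 coordinates changes nothing
at homogeneous cubics (`eval_bind₁_degreeRestrict`); a weight component surviving at `per_3` has a
monomial in the permutation coordinates `c_(P_τ)` only, of weight `∑_τ n_τ P_τ`; multiplying it by
`∏_τ (c_(P_(cτ)) c_(P_(c²τ)))^(n_τ)` (`c` the 3-cycle; `P_τ + P_(cτ) + P_(c²τ) = J`,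
`permMonomial_coset_sum`) balances the weight to `(∑ n_τ) · J` without changing the two evaluation
properties (`coeff_(P_τ) per_3 = 1`).

Route-independent file.  HONEST FRAMING: bookkeeping for an OPEN support item; nothing on `VP ≠ VNP`.
-/

set_option linter.dupNamespace false

noncomputable section

namespace Summit.ValiantsHypothesis.ValiantsHypothesis.Theorems.SchenstedIndex

open MvPolynomial Matrix
open Literature.Computability.AlgebraicComplexity

/-! ## The torus on coefficient space -/

/-- Torus scaling `x_i ↦ λ_i x_i` multiplies the coefficient of `x^d` by `λ^d = ∏_i λ_i^(d_i)`. -/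
theorem coeff_aeval_torus {σ : Type*} [Fintype σ] (lam : σ → ℂ) (f : MvPolynomial σ ℂ)
    (d : σ →₀ ℕ) :
    coeff d (aeval (fun i => C (lam i) * X i) f) = (∏ i, lam i ^ d i) * coeff d f := by
  classical
  induction f using MvPolynomial.induction_on' with
  | monomial e c =>
    have h : aeval (fun i => C (lam i) * X i) (monomial e c) =
        monomial e (c * ∏ i, lam i ^ e i) := by
      rw [aeval_monomial, algebraMap_eq, Finsupp.prod_pow, monomial_eq, Finsupp.prod_pow]
      simp_rw [mul_pow, Finset.prod_mul_distrib, ← map_pow, ← map_prod, map_mul]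
      ring
    rw [h, coeff_monomial, coeff_monomial]
    split_ifs with hed
    · subst hed; ring
    · rw [mul_zero]
  | add p q hp hq => rw [map_add, coeff_add, coeff_add, hp, hq, mul_add]

/-- The width-`n` power traces are torus-stable: scaling the pencil coefficients `M_ℓ ↦ λ_ℓ M_ℓ`
is the torus substitution `x_ℓ ↦ λ_ℓ x_ℓ` on `tr(A_M^k)`. -/
theorem tracePow_pencil_torus {σ : Type*} [Fintype σ] {n : ℕ} (k : ℕ)
    (M : σ → Matrix (Fin n) (Fin n) ℂ) (lam : σ → ℂ) :
    ((Matrix.of fun a b : Fin n => ∑ ℓ : σ,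
        C (lam ℓ * M ℓ a b) * (X ℓ : MvPolynomial σ ℂ)) ^ k).trace =
      aeval (fun ℓ : σ => C (lam ℓ) * (X ℓ : MvPolynomial σ ℂ))
        (((Matrix.of fun a b : Fin n => ∑ ℓ : σ,
          C (M ℓ a b) * (X ℓ : MvPolynomial σ ℂ)) ^ k).trace) := by
  set θ : MvPolynomial σ ℂ →ₐ[ℂ] MvPolynomial σ ℂ :=
    aeval (fun ℓ : σ => C (lam ℓ) * (X ℓ : MvPolynomial σ ℂ)) with hθ
  rw [AddMonoidHom.map_trace θ, ← AlgHom.mapMatrix_apply, map_pow, AlgHom.mapMatrix_apply]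
  congr 2
  refine Matrix.ext fun a b => ?_
  simp only [Matrix.map_apply, Matrix.of_apply, map_sum, map_mul, hθ, aeval_C, aeval_X,
    algebraMap_eq]
  refine Finset.sum_congr rfl fun ℓ _ => ?_
  ring

/-- On coefficient vectors: `coeffVec (tr A_(λM)^k) d = λ^d · coeffVec (tr A_M^k) d`. -/
theorem coeffVec_tracePow_pencil_torus {σ : Type*} [Fintype σ] {n : ℕ} (k : ℕ)
    (M : σ → Matrix (Fin n) (Fin n) ℂ) (lam : σ → ℂ) (d : σ →₀ ℕ) :
    coeffVec (((Matrix.of fun a b : Fin n => ∑ ℓ : σ,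
        C (lam ℓ * M ℓ a b) * (X ℓ : MvPolynomial σ ℂ)) ^ k).trace) d =
      (∏ i, lam i ^ d i) * coeffVec (((Matrix.of fun a b : Fin n => ∑ ℓ : σ,
        C (M ℓ a b) * (X ℓ : MvPolynomial σ ℂ)) ^ k).trace) d := by
  rw [coeffVec_apply, coeffVec_apply, tracePow_pencil_torus, coeff_aeval_torus]

/-! ## Torus-weight components of a polynomial on coefficient space -/

/-- A monomial `∏_d c_d^(e d)` in the coefficients has torus weight `∑_d e(d) · d`:
evaluating it at the scaled point `(λ^d v_d)_d` multiplies its value at `v` by `λ^(weight e)`. -/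
theorem eval_torus_monomial {σ : Type*} [Fintype σ] (lam : σ → ℂ) (v : (σ →₀ ℕ) → ℂ)
    (e : (σ →₀ ℕ) →₀ ℕ) (c : ℂ) :
    eval (fun d : σ →₀ ℕ => (∏ i, lam i ^ d i) * v d) (monomial e c) =
      (∏ i, lam i ^ (Finsupp.weight (fun d : σ →₀ ℕ => d) e) i) * eval v (monomial e c) := by
  classical
  rw [eval_monomial, eval_monomial]
  simp only [Finsupp.prod, mul_pow, Finset.prod_mul_distrib]
  have hw : ∀ i, (Finsupp.weight (fun d : σ →₀ ℕ => d) e) i = ∑ d ∈ e.support, e d * d i := by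
    intro i
    rw [Finsupp.weight_apply, Finsupp.sum, Finsupp.finsetSum_apply]
    simp only [Finsupp.smul_apply, smul_eq_mul]
  have hlam : (∏ d ∈ e.support, (∏ i, lam i ^ d i) ^ e d) =
      ∏ i, lam i ^ (Finsupp.weight (fun d : σ →₀ ℕ => d) e) i := by
    simp_rw [← Finset.prod_pow, ← pow_mul, hw]
    rw [Finset.prod_comm]
    refine Finset.prod_congr rfl fun i _ => ?_
    rw [Finset.prod_pow_eq_pow_sum]
    exact congrArg _ (Finset.sum_congr rfl fun d _ => mul_comm _ _)
  rw [hlam]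
  ring

/-- **Weight components vanish on torus-stable zero sets.** If `p` vanishes at all torus translates
`(λ^d v_d)_d` of a point `v`, then so does each of its torus-weight components (expand in the characters
`λ^w` and compare coefficients of the resulting polynomial identity in `λ`, `MvPolynomial.funext`). -/
theorem eval_weightedHomogeneousComponent_eq_zero_of_torus {σ : Type*} [Fintype σ]
    (p : MvPolynomial (σ →₀ ℕ) ℂ) (v : (σ →₀ ℕ) → ℂ)
    (h : ∀ lam : σ → ℂ, eval (fun d : σ →₀ ℕ => (∏ i, lam i ^ d i) * v d) p = 0) (w : σ →₀ ℕ) :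
    eval v (weightedHomogeneousComponent (fun d : σ →₀ ℕ => d) w p) = 0 := by
  classical
  set W : Finset (σ →₀ ℕ) := p.support.image (Finsupp.weight (fun d : σ →₀ ℕ => d)) with hW
  set B : (σ →₀ ℕ) → ℂ := fun w' =>
    eval v (weightedHomogeneousComponent (fun d : σ →₀ ℕ => d) w' p) with hB
  -- expansion of `p(λ • v)` in characters
  have hexp : ∀ lam : σ → ℂ, eval (fun d : σ →₀ ℕ => (∏ i, lam i ^ d i) * v d) p =
      ∑ w' ∈ W, (∏ i, lam i ^ w' i) * B w' := by
    intro lam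
    conv_lhs => rw [← p.support_sum_monomial_coeff, map_sum]
    rw [Finset.sum_congr rfl (fun e _ => eval_torus_monomial lam v e (coeff e p)),
      ← Finset.sum_fiberwise_of_maps_to (g := Finsupp.weight (fun d : σ →₀ ℕ => d)) (t := W)
        (fun e he => Finset.mem_image_of_mem _ he)]
    refine Finset.sum_congr rfl fun w' _ => ?_
    have hBw : B w' = ∑ e ∈ p.support with Finsupp.weight (fun d : σ →₀ ℕ => d) e = w',
        eval v (monomial e (coeff e p)) := by
      rw [hB]
      dsimp only
      rw [weightedHomogeneousComponent_apply, map_sum]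
    rw [hBw, Finset.mul_sum]
    refine Finset.sum_congr rfl fun e he => ?_
    rw [(Finset.mem_filter.mp he).2]
  -- the character sum vanishes identically, hence coefficientwise
  set P : MvPolynomial σ ℂ := ∑ w' ∈ W, monomial w' (B w') with hP
  have hPeval : ∀ lam : σ → ℂ, eval lam P = 0 := by
    intro lam
    rw [hP, map_sum]
    simp_rw [eval_monomial, Finsupp.prod_pow]
    rw [← h lam, hexp lam]
    exact Finset.sum_congr rfl fun w' _ => mul_comm _ _
  have hP0 : P = 0 := MvPolynomial.funext fun lam => by rw [hPeval, map_zero]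
  by_cases hw : w ∈ W
  · have hc := congrArg (coeff w) hP0
    rw [hP, coeff_sum, coeff_zero, Finset.sum_eq_single w] at hc
    · rwa [coeff_monomial, if_pos rfl] at hc
    · intro w' _ hne
      rw [coeff_monomial, if_neg hne]
    · exact fun hw' => absurd hw hw'
  · rw [weightedHomogeneousComponent_eq_zero', map_zero]
    intro e he hwe
    exact hw (hwe ▸ Finset.mem_image_of_mem _ he)

/-- A polynomial is the (finite) sum of its weight components over the weights of its monomials. -/
theorem sum_weightedHomogeneousComponent_image {τ R M : Type*} [CommSemiring R] [AddCommMonoid M]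
    [DecidableEq M] (wt : τ → M) (p : MvPolynomial τ R) :
    ∑ w ∈ p.support.image (Finsupp.weight wt), weightedHomogeneousComponent wt w p = p := by
  conv_rhs => rw [← sum_weightedHomogeneousComponent wt p]
  refine (finsum_eq_sum_of_support_subset _ ?_).symm
  intro w hw
  rw [Function.mem_support] at hw
  by_contra hnot
  apply hw
  apply weightedHomogeneousComponent_eq_zero'
  intro d hd hwd
  exact hnot (by rw [Finset.mem_coe]; exact hwd ▸ Finset.mem_image_of_mem _ hd)

/-- **A surviving monomial.** If `p(v) ≠ 0`, some weight component `p_w` has `p_w(v) ≠ 0`, witnessed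
by a monomial of `p` of weight `w` all of whose coordinates are nonzero at `v`. -/
theorem exists_weight_monomial_of_eval_ne_zero {σ : Type*} (p : MvPolynomial (σ →₀ ℕ) ℂ)
    (v : (σ →₀ ℕ) → ℂ) (hv : eval v p ≠ 0) :
    ∃ w : σ →₀ ℕ, ∃ e : (σ →₀ ℕ) →₀ ℕ, coeff e p ≠ 0 ∧ Finsupp.weight (fun d : σ →₀ ℕ => d) e = w ∧
      (∀ d ∈ e.support, v d ≠ 0) ∧
      eval v (weightedHomogeneousComponent (fun d : σ →₀ ℕ => d) w p) ≠ 0 := by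
  classical
  rw [← sum_weightedHomogeneousComponent_image (fun d : σ →₀ ℕ => d) p, map_sum] at hv
  obtain ⟨w, _, hw⟩ := Finset.exists_ne_zero_of_sum_ne_zero hv
  have hw' := hw
  rw [weightedHomogeneousComponent_apply, map_sum] at hw'
  obtain ⟨e, he, hne⟩ := Finset.exists_ne_zero_of_sum_ne_zero hw'
  refine ⟨w, e, mem_support_iff.mp (Finset.mem_filter.mp he).1, (Finset.mem_filter.mp he).2,
    fun d hd hvd => hne ?_, hw⟩
  rw [eval_monomial, Finsupp.prod, Finset.prod_eq_zero hd (by rw [hvd, zero_pow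
    (Finsupp.mem_support_iff.mp hd)]), mul_zero]

/-! ## Restriction to the degree-`m` coordinates -/

/-- Restricting a polynomial on coefficient space to the degree-`m` coordinates (substituting `0` for
every `c_d` with `|d| ≠ m`) does not change its values at points supported in degree `m`. -/
theorem eval_bind₁_degreeRestrict {σ : Type*} (m : ℕ) (p : MvPolynomial (σ →₀ ℕ) ℂ)
    (v : (σ →₀ ℕ) → ℂ) (hv : ∀ d, Finsupp.degree d ≠ m → v d = 0) :
    eval v (bind₁ (fun d : σ →₀ ℕ =>
      if Finsupp.degree d = m then (X d : MvPolynomial (σ →₀ ℕ) ℂ) else 0) p) = eval v p := by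
  show aeval v (bind₁ _ p) = aeval v p
  rw [aeval_bind₁]
  have : (fun d : σ →₀ ℕ => aeval v
      (if Finsupp.degree d = m then (X d : MvPolynomial (σ →₀ ℕ) ℂ) else 0)) = v := by
    funext d
    split_ifs with hd
    · rw [aeval_X]
    · rw [map_zero, hv d hd]
  rw [this]

/-- Every coordinate occurring in the restricted polynomial has degree `m`. -/
theorem degree_eq_of_mem_support_bind₁_degreeRestrict {σ : Type*} (m : ℕ)
    (p : MvPolynomial (σ →₀ ℕ) ℂ) {e : (σ →₀ ℕ) →₀ ℕ}
    (he : e ∈ (bind₁ (fun d : σ →₀ ℕ =>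
      if Finsupp.degree d = m then (X d : MvPolynomial (σ →₀ ℕ) ℂ) else 0) p).support)
    {d : σ →₀ ℕ} (hd : d ∈ e.support) : Finsupp.degree d = m := by
  classical
  set ω : (σ →₀ ℕ) → ℕ := fun d => if Finsupp.degree d = m then 0 else 1 with hω
  have hhom : IsWeightedHomogeneous ω (bind₁ (fun d : σ →₀ ℕ =>
      if Finsupp.degree d = m then (X d : MvPolynomial (σ →₀ ℕ) ℂ) else 0) p) 0 := by
    conv => arg 2; rw [← p.support_sum_monomial_coeff, map_sum]
    refine IsWeightedHomogeneous.sum _ _ _ fun ε _ => ?_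
    rw [bind₁_monomial]
    have h1 : IsWeightedHomogeneous ω (∏ i ∈ ε.support,
        (if Finsupp.degree i = m then (X i : MvPolynomial (σ →₀ ℕ) ℂ) else 0) ^ ε i)
        (∑ i ∈ ε.support, (0 : ℕ)) :=
      IsWeightedHomogeneous.prod _ _ _ fun i _ => by
        split_ifs with hi
        · have hX := isWeightedHomogeneous_X ℂ ω i
          rw [show ω i = 0 by simp [hω, hi]] at hX
          simpa using hX.pow (ε i)
        · simpa using (isWeightedHomogeneous_zero ℂ ω 0).pow (ε i)
    rw [Finset.sum_const_zero] at h1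
    simpa using (isWeightedHomogeneous_C ω (coeff ε p)).mul h1
  have hwe : Finsupp.weight ω e = 0 := by
    by_contra hne
    exact (mem_support_iff.mp he) (hhom.coeff_eq_zero e hne)
  rw [Finsupp.weight_apply, Finsupp.sum, Finset.sum_eq_zero_iff] at hwe
  have h := hwe d hd
  by_contra hdm
  simp only [hω, hdm, if_false, smul_eq_mul, mul_one] at h
  exact (Finsupp.mem_support_iff.mp hd) h

/-! ## Permutation coordinates and the padding -/

/-- A permutation exponent has degree `n`. -/
theorem degree_permMonomial {n : ℕ} (ρ : Equiv.Perm (Fin n)) :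
    Finsupp.degree (permMonomial ρ) = n := by
  unfold permMonomial
  rw [map_sum]
  simp [Finsupp.degree_single]

/-- Pointwise form of `permMonomial_coset_sum`: the orbit of a point under the 3-cycle hits every
value exactly once. -/
theorem coset_indicator_three (x r : Fin 3) :
    ((if x = r then 1 else 0) + (if finRotate 3 x = r then 1 else 0) +
      (if finRotate 3 (finRotate 3 x) = r then 1 else 0) : ℕ) = 1 := by
  revert x r
  decide

/-- The three cosets of the 3-cycle tile the all-ones exponent:
`P_τ + P_(cτ) + P_(c²τ) = J = ∑_ℓ e_ℓ` (`c = finRotate 3`). -/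
theorem permMonomial_coset_sum (τ : Equiv.Perm (Fin 3)) :
    permMonomial τ + permMonomial (τ.trans (finRotate 3)) +
        permMonomial (τ.trans ((finRotate 3).trans (finRotate 3))) =
      ∑ ℓ : Fin 3 × Fin 3, Finsupp.single ℓ 1 := by
  ext ⟨r, col⟩
  simp only [Finsupp.add_apply, permMonomial_apply, Equiv.trans_apply, Finsupp.finsetSum_apply,
    Finsupp.single_apply]
  rw [Finset.sum_eq_single (r, col)]
  · simp only [if_true]
    exact coset_indicator_three (τ col) r
  · intro ℓ _ hℓ
    rw [if_neg hℓ]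
  · exact fun h => absurd (Finset.mem_univ _) h

/-- The entries of a power of a pencil `A_M = ∑_ℓ x_ℓ M_ℓ` are forms of the same degree. -/
theorem isHomogeneous_pow_pencil_apply {σ : Type*} [Fintype σ] {n : ℕ}
    (M : σ → Matrix (Fin n) (Fin n) ℂ) (k : ℕ) (a b : Fin n) :
    (((Matrix.of fun a b : Fin n => ∑ ℓ : σ,
        C (M ℓ a b) * (X ℓ : MvPolynomial σ ℂ)) ^ k) a b).IsHomogeneous k := by
  induction k generalizing a b with
  | zero =>
      rw [pow_zero, Matrix.one_apply]
      split_ifs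
      · exact isHomogeneous_one _ _
      · exact isHomogeneous_zero _ _ _
  | succ k ih =>
      rw [pow_succ, Matrix.mul_apply]
      refine IsHomogeneous.sum _ _ _ fun l _ => ?_
      have hX : ((Matrix.of fun a b : Fin n => ∑ ℓ : σ,
          C (M ℓ a b) * (X ℓ : MvPolynomial σ ℂ)) l b).IsHomogeneous 1 := by
        rw [Matrix.of_apply]
        refine IsHomogeneous.sum _ _ _ fun ℓ _ => ?_
        have h := (isHomogeneous_C σ (M ℓ l b)).mul (isHomogeneous_X ℂ ℓ)
        rwa [zero_add] at h
      exact (ih a l).mul hX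

/-- The power trace `tr(A_M^k)` of a pencil is a form of degree `k`. -/
theorem isHomogeneous_tracePow_pencil {σ : Type*} [Fintype σ] {n : ℕ}
    (M : σ → Matrix (Fin n) (Fin n) ℂ) (k : ℕ) :
    (((Matrix.of fun a b : Fin n => ∑ ℓ : σ,
        C (M ℓ a b) * (X ℓ : MvPolynomial σ ℂ)) ^ k).trace).IsHomogeneous k := by
  unfold Matrix.trace
  exact IsHomogeneous.sum _ _ _ fun i _ => isHomogeneous_pow_pencil_apply M k i i

/-- The coordinates of the coset padding exponent are permutation coordinates. -/
theorem exists_permMonomial_eq_of_mem_support_padding (n : Equiv.Perm (Fin 3) → ℕ)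
    {d : (Fin 3 × Fin 3) →₀ ℕ}
    (hd : d ∈ (∑ ρ : Equiv.Perm (Fin 3), n ρ •
      ((Finsupp.single (permMonomial (ρ.trans (finRotate 3))) 1 : ((Fin 3 × Fin 3) →₀ ℕ) →₀ ℕ) +
        Finsupp.single (permMonomial (ρ.trans ((finRotate 3).trans (finRotate 3)))) 1)).support) :
    ∃ ρ : Equiv.Perm (Fin 3), permMonomial ρ = d := by
  classical
  obtain ⟨ρ, _, hρ⟩ := Finset.mem_biUnion.mp (Finsupp.support_finsetSum hd)
  rcases Finset.mem_union.mp (Finsupp.support_add (Finsupp.support_smul hρ)) with h | h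
  · exact ⟨_, (Finset.mem_singleton.mp (Finsupp.support_single_subset h)).symm⟩
  · exact ⟨_, (Finset.mem_singleton.mp (Finsupp.support_single_subset h)).symm⟩

end Summit.ValiantsHypothesis.ValiantsHypothesis.Theorems.SchenstedIndex

end
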